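import Literature.Combinatorics.Matroid.HeppBoundIdentities
import Mathlib.Tactic.LinearCombination
import Mathlib.Tactic.Ring
import HarnessLib

/-!
# Identities of the Hepp bound, II: duality (Panzer 2022, Prop. 4.5) and connectivity — proved

For a finite matroid `M` with dual `M✶` and indices `a⃗`, set `a_e^∨ := D/2 - a_e`. Panzer's
Proposition 4.5 [Panzer2022]: `H(M✶, a⃗) = H(M, a⃗^∨)`, both sides in the common dimension `D`
in which `ω_{a⃗}(M✶) = 0`, equivalently `ω_{a⃗^∨}(M) = 0`. We prove it for the pointwise Hepp
bound `heppBoundDim` of `Literature/Combinatorics/Matroid/HeppBound.lean`, following the printed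
proof: the dual corank is `ℓ^∨(γ) = ℓ(E ∖ γ) + |γ| - ℓ(E)` (§4.1 there; Mathlib's
`Matroid.eRk_dual_add_eRank`), hence `ω_{a⃗}^{M✶}(γ) = ω_{a⃗^∨}^{M}(E ∖ γ)` on the hyperplane
`ω_{a⃗^∨}(M) = 0`, and the contribution of an ordering `σ` to `H(M✶, a⃗)` is the contribution
of the reversed ordering to `H(M, a⃗^∨)` (complementary flags). We also record the rank form of
matroid connectivity (`IsConnectedMatroid`, Def. 2.15) used in Panzer's proofs.

## Contents

* `groundFinset_dual`, `corank_dual_add` (the dual corank, subtraction-free),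
  `sdc_dual` (`ω` of the dual = `ω^∨` of the complement, on the hyperplane),
* `heppBoundDim_dual` — **Prop. 4.5**: `heppBoundDim M✶ D a = heppBoundDim M D (D/2 - a)` under
  `sdc M D (D/2 - a) E = 0`.
* `eRk_add_eRk_eq_eRank_of_eq_disjointSum`, `eq_disjointSum_of_eRk_add_eRk_eq_eRank`,
  `isConnectedMatroid_iff_eRk` — `IsConnectedMatroid` (Def. 2.15, via `disjointSum`) in the rank
  form "no separator": `r(X) + r(E ∖ X) ≠ r(M)` for non-empty proper `X` (Oxley §4.2), the form
  used in Panzer's proofs of Lemma 2.16 / Prop. 2.31.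
-/

noncomputable section

open Finset

namespace Literature.Combinatorics.Matroid

variable {α : Type*} {𝕜 : Type*} [Field 𝕜]

/-- The dual matroid has the same ground finset. [folklore] -/
@[simp] theorem groundFinset_dual (M : Matroid α) [M.Finite] :
    groundFinset M✶ = groundFinset M := by
  ext e
  simp

/-- **The dual corank** (Panzer 2022, eq. (4.3): `ℓ^∨(γ) = ℓ(E ∖ γ) + |γ| - ℓ(E)`), in the
subtraction-free form `ℓ^∨(γ) + ℓ(E) = ℓ(E ∖ γ) + |γ|` (from Mathlib's dual rank formula
`r^∨(γ) + r(E) = r(E ∖ γ) + |γ|`). [cite: Panzer2022, §4.1 (dual corank)] -/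
theorem corank_dual_add [DecidableEq α] (M : Matroid α) [M.Finite] (γ : Finset α)
    (hγ : γ ⊆ groundFinset M) :
    corank M✶ γ + corank M (groundFinset M) =
      corank M (groundFinset M \ γ) + γ.card := by
  have hγE : (γ : Set α) ⊆ M.E := by
    intro x hx
    exact mem_groundFinset.1 (hγ (Finset.mem_coe.1 hx))
  have h := M.eRk_dual_add_eRank (γ : Set α) hγE
  rw [Matroid.eRank_def, ← coe_groundFinset M, ← Finset.coe_sdiff,
    Set.encard_coe_eq_coe_finsetCard] at h
  -- all ranks are finite: pass to `ℕ`
  have h1 := eRk_toNat_add_corank M✶ γ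
  have h2 := eRk_toNat_add_corank M (groundFinset M)
  have h3 := eRk_toNat_add_corank M (groundFinset M \ γ)
  have hfin : ∀ (N : Matroid α) (s : Finset α), N.eRk (s : Set α) ≠ ⊤ := fun N s =>
    ne_top_of_le_ne_top (ENat.coe_ne_top s.card)
      (by rw [← Set.encard_coe_eq_coe_finsetCard]; exact N.eRk_le_encard _)
  have h' : (M✶.eRk (γ : Set α)).toNat + (M.eRk (groundFinset M : Set α)).toNat =
      (M.eRk ((groundFinset M \ γ : Finset α) : Set α)).toNat + γ.card := by
    have := congr_arg ENat.toNat h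
    rwa [ENat.toNat_add (hfin _ _) (hfin _ _), ENat.toNat_add (hfin _ _) (ENat.coe_ne_top _),
      ENat.toNat_coe] at this
  have hcard : (groundFinset M \ γ).card + γ.card = (groundFinset M).card :=
    Finset.card_sdiff_add_card_eq_card hγ
  omega

/-- **`ω` of the dual is `ω^∨` of the complement** (Panzer 2022, proof of Prop. 4.5:
`ω_{a⃗}(γ^∨) = ω_{a⃗^∨}(M ∖ γ)` once `(D/2) ℓ(M) = Σ_e a_e^∨`, i.e. on the hyperplane
`ω_{a⃗^∨}(M) = 0`), for `γ ⊆ E`. [cite: Panzer2022, Prop. 4.5 (proof)] -/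
theorem sdc_dual [DecidableEq α] (M : Matroid α) [M.Finite] (D : 𝕜) (a : α → 𝕜) (γ : Finset α)
    (hγ : γ ⊆ groundFinset M)
    (h0 : sdc M D (fun e => D / 2 - a e) (groundFinset M) = 0) :
    sdc M✶ D a γ = sdc M D (fun e => D / 2 - a e) (groundFinset M \ γ) := by
  have hc : (corank M✶ γ : 𝕜) + corank M (groundFinset M) =
      corank M (groundFinset M \ γ) + γ.card := by
    have := congr_arg (Nat.cast : ℕ → 𝕜) (corank_dual_add M γ hγ)
    push_cast at this
    exact this
  have hs : (∑ e ∈ groundFinset M \ γ, (D / 2 - a e)) + ∑ e ∈ γ, (D / 2 - a e) =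
      ∑ e ∈ groundFinset M, (D / 2 - a e) :=
    Finset.sum_sdiff hγ
  have hγs : ∑ e ∈ γ, (D / 2 - a e) = γ.card * (D / 2) - ∑ e ∈ γ, a e := by
    rw [Finset.sum_sub_distrib, Finset.sum_const, nsmul_eq_mul]
  simp only [sdc_apply] at h0 ⊢
  linear_combination (-(D / 2)) * hc - hs + hγs - h0

/-- **Duality of the Hepp bound** (Panzer 2022, Prop. 4.5: `H(M✶, a⃗) = H(M, a⃗^∨)` with
`a_e^∨ = D/2 - a_e`), for the pointwise Hepp bound in the common dimension `D` determined by
logarithmic divergence `ω_{a⃗^∨}(M) = 0` (equivalently `ω_{a⃗}(M✶) = 0`). Proof as printed: each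
ordering contributes to `H(M✶, a⃗)` what the reversed ordering (complementary flag) contributes
to `H(M, a⃗^∨)`. [cite: Panzer2022, Prop. 4.5] -/
theorem heppBoundDim_dual [DecidableEq α] (M : Matroid α) [M.Finite] (D : 𝕜) (a : α → 𝕜)
    (h0 : sdc M D (fun e => D / 2 - a e) (groundFinset M) = 0) :
    heppBoundDim M✶ D a = heppBoundDim M D (fun e => D / 2 - a e) := by
  rw [heppBoundDim, heppBoundDim, groundFinset_dual, heppSumOfCorank_eq, heppSumOfCorank_eq]
  refine Finset.sum_nbij' (fun l => l.reverse) (fun l => l.reverse)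
    (fun l hl => reverse_mem_orderings hl) (fun l hl => reverse_mem_orderings hl)
    (fun l _ => List.reverse_reverse l) (fun l _ => List.reverse_reverse l) ?_
  intro l hl
  have hlen := length_of_mem_orderings hl
  -- each factor: `ω^{M✶}_a({l₁..l_k}) = ω^M_{a^∨}({l_{k+1}..l_N})`
  have hfac : ∀ k ∈ Finset.Ico 1 (groundFinset M).card,
      (sdcOfCorank (corank M✶) D a (l.take k).toFinset)⁻¹ =
        (sdcOfCorank (corank M) D (fun e => D / 2 - a e) (l.drop k).toFinset)⁻¹ := by
    intro k _
    have hsub : (l.take k).toFinset ⊆ groundFinset M := by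
      intro x hx
      rw [List.mem_toFinset] at hx
      exact (mem_iff_of_mem_orderings hl).1 (List.mem_of_mem_take hx)
    change (sdc M✶ D a (l.take k).toFinset)⁻¹ =
      (sdc M D (fun e => D / 2 - a e) (l.drop k).toFinset)⁻¹
    rw [sdc_dual M D a _ hsub h0, sdiff_toFinset_take hl]
  rw [Finset.prod_congr rfl hfac]
  -- reflect `k ↦ N - k`: `{l_{k+1}, …, l_N}` are the first `N - k` elements of `l.reverse`
  refine Finset.prod_nbij' (fun k => (groundFinset M).card - k)
    (fun k => (groundFinset M).card - k) ?_ ?_ ?_ ?_ ?_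
  · intro k hk
    simp only [Finset.mem_Ico] at hk ⊢
    omega
  · intro k hk
    simp only [Finset.mem_Ico] at hk ⊢
    omega
  · intro k hk
    simp only [Finset.mem_Ico] at hk
    omega
  · intro k hk
    simp only [Finset.mem_Ico] at hk
    omega
  · intro k hk
    simp only [Finset.mem_Ico] at hk
    rw [List.take_reverse, List.toFinset_reverse, hlen, Nat.sub_sub_self hk.2.le]

/-! ### Connectivity via ranks (Oxley §4.2: separators) -/

section Connectivity

variable {M : Matroid α}

/-- If `M` splits as `M|X ⊕ M|(E ∖ X)` then the ranks add up: `r(X) + r(E ∖ X) = r(M)`. [folklore] -/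
theorem eRk_add_eRk_eq_eRank_of_eq_disjointSum {X : Set α} (hX : X ⊆ M.E)
    (h : M = (M.restrict X).disjointSum (M.restrict (M.E \ X)) Set.disjoint_sdiff_right) :
    M.eRk X + M.eRk (M.E \ X) = M.eRank := by
  obtain ⟨B, hB⟩ := M.exists_isBase
  have hB' := hB
  rw [h, Matroid.disjointSum_isBase_iff] at hB'
  obtain ⟨h1, h2, -⟩ := hB'
  rw [Matroid.restrict_ground_eq, Matroid.isBase_restrict_iff hX] at h1
  rw [Matroid.restrict_ground_eq, Matroid.isBase_restrict_iff Set.sdiff_subset] at h2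
  have hdisj : Disjoint (B ∩ X) (B ∩ (M.E \ X)) :=
    Set.disjoint_sdiff_right.mono Set.inter_subset_right Set.inter_subset_right
  rw [← h1.encard_eq_eRk, ← h2.encard_eq_eRk, ← hB.encard_eq_eRank, ← Set.encard_union_eq hdisj,
    ← Set.inter_union_distrib_left, Set.union_sdiff_cancel hX,
    Set.inter_eq_self_of_subset_left hB.subset_ground]

/-- Conversely, in a matroid of finite rank, rank additivity `r(X) + r(E ∖ X) = r(M)` along
`X ⊆ E` splits `M` as the direct sum `M|X ⊕ M|(E ∖ X)` (`X` is a separator). [folklore] -/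
theorem eq_disjointSum_of_eRk_add_eRk_eq_eRank [M.RankFinite] {X : Set α} (hX : X ⊆ M.E)
    (h : M.eRk X + M.eRk (M.E \ X) = M.eRank) :
    M = (M.restrict X).disjointSum (M.restrict (M.E \ X)) Set.disjoint_sdiff_right := by
  refine Matroid.ext_indep (by simp [Set.union_sdiff_cancel hX]) (fun I hI => ?_)
  rw [Matroid.disjointSum_indep_iff]
  simp only [Matroid.restrict_ground_eq, Matroid.restrict_indep_iff, Set.union_sdiff_cancel hX]
  constructor
  · intro hind
    exact ⟨⟨hind.subset Set.inter_subset_left, Set.inter_subset_right⟩,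
      ⟨hind.subset Set.inter_subset_left, Set.inter_subset_right⟩, hI⟩
  · rintro ⟨⟨hA, -⟩, ⟨hB, -⟩, hIE⟩
    obtain ⟨JA, hJA, hAJA⟩ := hA.subset_isBasis_of_subset (Set.inter_subset_right : I ∩ X ⊆ X)
    obtain ⟨JB, hJB, hBJB⟩ :=
      hB.subset_isBasis_of_subset (Set.inter_subset_right : I ∩ (M.E \ X) ⊆ M.E \ X)
    have hdisj : Disjoint JA JB := Set.disjoint_sdiff_right.mono hJA.subset hJB.subset
    have hfin : (JA ∪ JB).Finite := hJA.indep.finite.union hJB.indep.finite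
    have hrk : M.eRk (JA ∪ JB) = M.eRank := by
      refine le_antisymm (M.eRk_le_eRank _) ?_
      calc M.eRank = M.eRk (X ∪ (M.E \ X)) := by rw [Set.union_sdiff_cancel hX, Matroid.eRank_def]
        _ ≤ M.eRk (M.closure JA ∪ M.closure JB) :=
            M.eRk_mono (Set.union_subset_union hJA.subset_closure hJB.subset_closure)
        _ = M.eRk (JA ∪ JB) := by
            rw [← M.eRk_closure_eq (M.closure JA ∪ M.closure JB),
              Matroid.closure_closure_union_closure_eq_closure_union, M.eRk_closure_eq]
    have hcard : (JA ∪ JB).encard = M.eRk X + M.eRk (M.E \ X) := by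
      rw [Set.encard_union_eq hdisj, hJA.encard_eq_eRk, hJB.encard_eq_eRk]
    have hind : M.Indep (JA ∪ JB) := by
      rw [Matroid.indep_iff_eRk_eq_encard_of_finite hfin, hrk, hcard, h]
    refine hind.subset ?_
    calc I = I ∩ (X ∪ (M.E \ X)) := by
          rw [Set.union_sdiff_cancel hX, Set.inter_eq_self_of_subset_left hIE]
      _ = I ∩ X ∪ I ∩ (M.E \ X) := Set.inter_union_distrib_left _ _ _
      _ ⊆ JA ∪ JB := Set.union_subset_union hAJA hBJB

/-- **Connectivity via ranks** (Oxley §4.2; Panzer 2022, proofs of Lemma 2.16 and Prop. 2.31: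
"`ℓ(M) = ℓ(γ) + ℓ(γ^c)` would imply that `M ≅ γ ⊕ γ^c` is disconnected"): a matroid of finite
rank is connected iff no non-empty proper `X ⊊ E` has `r(X) + r(E ∖ X) = r(M)`. [folklore] -/
theorem isConnectedMatroid_iff_eRk [M.RankFinite] :
    IsConnectedMatroid M ↔
      ∀ X : Set α, X ⊆ M.E → X.Nonempty → X ≠ M.E → M.eRk X + M.eRk (M.E \ X) ≠ M.eRank := by
  refine ⟨fun h X hX hne hpr hr => h X hX hne hpr (eq_disjointSum_of_eRk_add_eRk_eq_eRank hX hr),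
    fun h X hX hne hpr hM => h X hX hne hpr (eRk_add_eRk_eq_eRank_of_eq_disjointSum hX hM)⟩

end Connectivity

end Literature.Combinatorics.Matroid
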